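import Summits.AtomisticToContinuum.FouriersLaw.Theses.EmbeddedDrudeMourre
import Summits.AtomisticToContinuum.FouriersLaw.Theorems.FGRGap.Negative.LoadBearing
import Summits.AtomisticToContinuum.FouriersLaw.Theorems.FGRGap.Negative.OnsiteReduction

/-!
# Line `fold-jet-rigidity` for crux `EmbeddedDrudeMourre.FGRGap` (stmt-AtomisticToContinuum-12595)

Crux (rank 3 of route EmbeddedDrudeMourre, FIXED):
`FGRGap := ∀ ω₂ a b : ℝ, 0 < ω₂ → 0 < a → 0 < b → PhononBoltzmann.HasOddSectorGap ω₂ a b` — the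
odd-sector gap `∃ g > 0, g‖f‖² ≤ q(f)` of ALS's linearised 2↔2 phonon-Boltzmann form `q = boltzmannForm`
of the pinned band `ω(k)² = ω₂ + 2(1 - cos k)`, vertex `Φ = a + 16b ∏ sin(k_j/2)`.

Idea card `Cruxes/FGRGap/Ideas/fold-jet-rigidity.md` (ideator 2, round 1; triage r1-1/2/3: pass ×3,
merge ≈ `grazing-jet-rigidity`). ARCHITECTURE (the card's C⁺, now the composition of this file):

  FGRGap ⇐ (S4 closing)[ (S3 essential gap) , (no odd L² null vector ⇐ (S2 regularity) + (S1 jet)) ].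

* S1 `stub_foldJetRigidity` — THE LEVER: every `C³` `2π`-periodic collisional invariant of the pinned
  band is `c + d·ω` (third-order jet of the invariant identity at the equal-group-velocity fold:
  order 1 gives `ψ' = G ∘ ω'`, order 3 gives `G'' = 0` because `ω''(k) + ω''(k*) ≠ 0`; `C²`-gluing at
  `k = 0, π` and `∮ψ' = 0`). Vertex-free; every `ω₂ > 0`.
* S2 `stub_nullVectorRegularity` — an odd `L²` null vector of `q` (`0 < a`, `0 ≤ b`) agrees a.e. on
  the cell with an odd `C³` periodic collisional invariant (LS08 §5 averaging device moved to the
  pinned band: `q(f) = 0` ⇒ bracket `= 0` a.e. on the non-perturbative surface; average the identity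
  against a bump in `k₃` and change variables along `k₃ ↦ h`, `k₃ ↦ k₄`, submersions off curves).
* S3 `stub_oddEssentialGap` — THE ANALYTIC ESTIMATE (uses `0 < a`): along every WEAKLY-NULL sequence
  of odd unit vectors, `liminf q ≥ v₀(ω₂,a,b) > 0` (bottom of the odd essential spectrum; Lukkarinen's
  mollified comparison `q ≥ V' - K'`, `inf V' > 0`, `K'` compact — or log-coercivity). Strictly WEAKER
  than the crux (a gap bounds `q` below on ALL unit vectors).
* S4 `stub_gapOfEssentialGap` — THE CLOSING (soft): essential gap ∧ no odd null vector ⇒ gap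
  (normalise a violating sequence, extract a weak limit in `L²(cell)`; weak limit `0` contradicts S3,
  weak limit `≠ 0` is an odd null vector by WEAK LOWER SEMICONTINUITY OF THE FULL FORM `q` (convex +
  Fatou along a.e.-convergent subsequences, pull-backs by `h`, `k₄` non-singular) — the null space of a
  truncated form is never needed, which is the card's repair of [Luk16 §3.4]).
* Composition (sorry-free, kernel-checked): `noOddSmoothInvariant` (S1 + parity: `c + dω` odd, `ω` even
  ⇒ `0`), `noOddNullVector` (S2 + that), `hasOddSectorGap_of_stubs` (S4 fed S3 and that; stated for
  `0 ≤ b`, so the line also yields ALS's on-site gap `b = 0`, which `onsite_of_crux` shows the crux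
  NEEDS), `FGRGap_of : FGRGap` (by name).

CONVENTIONS. Every stub is stated over TREE VOCABULARY ONLY (no local `def`, no notation), fully
unfolded, so that each lands verbatim as
`Summits/AtomisticToContinuum/FouriersLaw/Theorems/EmbeddedDrudeMourreFGRGap<Stub>.lean`
(`ledger propose … --supports stmt-AtomisticToContinuum-12595`) without importing this workfile; helper
files copy the `open` lines below and the stub statement byte-for-byte. `sorry` occurs only in the
four `stub_*`; `FGRGap_of` has no `sorry` of its own.

DISPROOF USED (`Cruxes/FGRGap/Disproof.lean`, cdisprove gen 2 c1, verdict NO KILL; landed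
`Theorems/FGRGap/Negative/{LoadBearing,OnsiteReduction}.lean`, both IMPORTED here and exercised in §3):
* `hasOddSectorGap_false_without_periodic` (witness `k ↦ k`): S2–S4 quantify over `2π`-periodic `f`
  only; S1's conclusion uses periodicity (`∮ψ' = 0` kills the affine part `αk`).
* `hasOddSectorGap_false_without_odd` (witness `1`): the even null vectors `1, ω` are exactly S1's
  output; parity removes them in `noOddSmoothInvariant`; S3/S4 quantify over odd sequences.
* `crux_false_without_omegaPos` (junk `ω₂ ≤ -4`): every stub carries `0 < ω₂` (S1: analytic band,
  `ω'(0) = ω₂^{-1/2} ≠ 0`; S2/S4: non-singular pull-backs; S3: kernel bounds `ω ≥ √ω₂`).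
* `crux_false_without_couplings` + sorried near-miss `not_hasOddSectorGap_zero_onsite` (`a = 0`
  gapless, `≍ ε²`): the line uses `H := (0 < a)` AT `stub_oddEssentialGap` (at `a = 0` the fibre
  `k₁ = 0` carries no collision rate, `inf V' = 0`, and the `ε`-bumps at `0` are a weakly-null odd unit
  sequence with `q → 0`: S3 is false there, S4 vacuous) — and NEVER uses `0 < b` (`0 ≤ b` throughout;
  `onsite_of_crux`/`crux_on_cone_of_onsite`).
* sorried `no_uniform_gap`: no stub claims uniformity in `ω₂` (`v₀ = v₀(ω₂,a,b)` is chosen after them).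
* `-- Targets`: none registered (no line picked yet). Landed Negative lemmas: none refutes an
  instance of any stub (checked by statement; §3 examples).
-/

noncomputable section

-- Helper/stub files: copy these four `open` lines verbatim.
open MeasureTheory Set Real Filter Topology
open scoped ENNReal
open Literature.MathematicalPhysics.KineticTheory.PhononBoltzmann
open Summit.AtomisticToContinuum.FouriersLaw.Theorems.FGRGap

namespace Summit.AtomisticToContinuum.FouriersLaw.Cruxes.FGRGap.FoldJetRigidity

/-- The crux, unfolded (pins this file's reading of it definitionally). -/
theorem fgrGap_iff :
    Summit.AtomisticToContinuum.FouriersLaw.Theses.EmbeddedDrudeMourre.FGRGap ↔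
      ∀ ω₂ a b : ℝ, 0 < ω₂ → 0 < a → 0 < b → HasOddSectorGap ω₂ a b := Iff.rfl

/-! ## 1. The stubs (S1–S4) -/

/-- **S1 — FOLD-JET RIGIDITY (the lever; classification of smooth collisional invariants).**
For every `ω₂ > 0`, every `C³`, `2π`-periodic `ψ` with `ψ(k₁) + ψ(k₂) = ψ(k₃) + ψ(k₁+k₂-k₃)`
whenever `ω(k₁) + ω(k₂) = ω(k₃) + ω(k₁+k₂-k₃)` is `c + d·ω`.
Why true (card; re-derived by all three triagers, jet law confirmed numerically to 3 digits with
linear-in-`t` convergence at ω₂ ∈ {0.05,…,20}): `v = ω' = sin/ω` is odd, unimodal on `(0,π)` with a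
single non-degenerate maximum at `k_m = arccos c₋ < π/2` (`v' = -(cos k - c₋)(cos k - c₊)/ω³`), so each
`k ∈ (0,π) \ {k_m}` has a conjugate `k* ≠ k` with `v(k*) = v(k)`. Along the fold family
`(k, K(t); k+t, K(t)-t)`, `K(0) = k*` (analytic branch: divide `Ω(k,·,k+t)` by `t` and apply the IFT
at `(k*, 0)`, `∂₂ = v'(k*) ≠ 0`), the invariant identity gives at order `t`: `ψ'(k) = ψ'(k*)`, hence
`ψ' = G ∘ v` on `(0,π)` with `G ∈ C²(0, v_max)`; at order `t³`:
`G''(v(k))·v'(k*)²(1 - σ²)/24 = 0`, `σ = v'(k)/v'(k*) < 0`, and `σ ≠ -1` for every `k ≠ k_m`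
(`v'(k) + v'(k*) > 0` on `(0,k_m)`: triage r1-1 B for ω₂ ∈ [0.01,200]; reported PROVED in gen-1's
NoOddC1Invariant.lean "nondegeneracy of every fold point"); so `G` is affine on `(0, v_max)`, likewise
on `(-v_max, 0)` from `(-π,0)`, and `ψ ∈ C²` at `k = 0` with `v'(0) = ω₂^{-1/2} ≠ 0` glues the two:
`ψ' = α + βv` on `𝕋`; `∮ψ' = 0` kills `α`; `ψ = c + βω`. The `C³` hypothesis is sharp in kind: the
`C¹` zigzag `sgn(k)(ω(k)-ω(0)) - (ω(π)-ω(0))k/π` passes both jet conditions and is no invariant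
(triage r1-1 D). Size L (IFT/analytic branch, third-order Taylor bookkeeping, the sign lemma).
Leans on: `dispersion`, `groupVelocity`, `hasDerivAt_dispersion`, `resonanceFn`,
`hasDerivAt_resonanceFn`, `isCollisionalInvariant_const_add_mul_dispersion`,
`analyticAt_dispersion` (PinnedChainResonantFinite), the tree's analytic implicit-function chart
`Literature/Analysis/Calculus/ImplicitChart.lean` (`ContDiffAt.implicitFunction`,
`analyticAt_implicitFunction`, for the branch `K(t)`); Mathlib `HasStrictDerivAt.to_localInverse`,
`taylor_mean_remainder_lagrange(_iteratedDeriv)`, `intervalIntegral.integral_eq_sub_of_hasDerivAt`;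
gen-1 evidence
`FGRGapOddInvariant.lean` (unimodality of `groupVelocity`, Möbius relation `ω(p)ω(p*) = √(ω₂(ω₂+4))`).
For the crux only the ODD instance is consumed (`noOddSmoothInvariant` below); gen-1's
`eq_zero_of_odd_isCollisionalInvariant` (odd, C¹; evidence 2026-08-15T22:49Z, not landed) implies that
instance — a lead may reshape S1 to it without touching S2–S4.
[AokiLukkarinenSpohn2006 §4 (4.9); LukkarinenSpohn2008 Thm 2.2 (FPU analogue); Spohn2006 (d ≥ 2)] -/
theorem stub_foldJetRigidity :
    ∀ ω₂ : ℝ, 0 < ω₂ → ∀ ψ : ℝ → ℝ, ContDiff ℝ 3 ψ → Function.Periodic ψ (2 * π) →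
      IsCollisionalInvariant ω₂ ψ → ∃ c d : ℝ, ∀ k : ℝ, ψ k = c + d * dispersion ω₂ k := by
  sorry

/-- **S2 — REGULARITY OF ODD NULL VECTORS (averaging bootstrap).** For `ω₂ > 0`, `a > 0`, `b ≥ 0`:
an odd `2π`-periodic measurable `f` with `‖f‖²_{L²(cell)} < ∞` and `q(f) = 0` agrees a.e. on the cell
`(-π, π]` with an odd `C³` `2π`-periodic collisional invariant `ψ`.
Why true: `q` is a lower Lebesgue integral of `∑_{k₂ resonant} w·(f₁+f₂-f₃-f₄)²` with `w > 0` off a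
null set (vertex zero set = a curve of the resonant surface iff `a ≤ 4b`, empty otherwise; Jacobian
junk only where `∂₂Ω = 0`), so `q(f) = 0` forces `f(k₁) = f(k₃) + f(k₄(k₁,k₃)) - f(h(k₁,k₃))` for a.e.
`(k₁,k₃)`, `h` = the non-perturbative root, `k₄ = k₁ + h - k₃`. Multiply by a bump `φ(k₃)` supported
where `k₃ ↦ h` and `k₃ ↦ k₄` are submersions and change variables
(`MeasureTheory.integral_image_eq_integral_abs_deriv_smul`): `f(k₁)∫φ = ∫ f(u) Θ(k₁,u) du` with `Θ`
smooth and compactly supported ⇒ `f` is a.e. equal to a smooth function near every `k₁` (LS08 §5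
p.16: "this way even smoothness could be proved"); the charts are unobstructed for the pinned band:
`∂₃h - 1 ≠ 0` EVERYWHERE and `∂₃h = 0` on exactly two transversal curves per `k₁`-row (Disproof §3(C),
ω₂ ∈ {0.2,1,4,20}; `∂₁h ≠ 0` always, card A rev 2), no fibre `{k₁}×𝕋` is lost. Patch by periodicity,
replace `ψ` by its odd part (`IsCollisionalInvariant.oddPart`; `f` odd), and pass the a.e. identity to
the limit on the closure of the good set (continuity) to get `IsCollisionalInvariant` at every real
resonance (trivial branches `k₂ = k₃`, `k₃ = k₁` hold identically). Why it might fail: a component of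
the non-perturbative surface on which the a.e. identity cannot be propagated to every point by
continuity (singular points not in the closure of chart points) — none known; the unique-root
structure (one non-trivial `k₂` per off-diagonal `(k₁,k₃)`, chord picture of card chord-quartic-abel)
says the surface is a smooth graph. Size L (measure theory of the charts is the bulk).
Leans on: `boltzmannForm`, `resonantSet`, `resonantSet_finite` (PinnedChainResonantFinite),
`collisionWeight(_nonneg)`, `hasDerivAt_resonanceFn`, `IsCollisionalInvariant.oddPart`, `cellNormSq`;
Mathlib `MeasureTheory.lintegral_eq_zero_iff`, `integral_image_eq_integral_abs_deriv_smul`,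
`ContDiff` under the integral sign (`hasFDerivAt_integral_of_dominated_of_fderiv_le`).
[LukkarinenSpohn2008 §5 (arXiv:0704.1607 p.16); Disproof.lean §3(C)] -/
theorem stub_nullVectorRegularity :
    ∀ ω₂ a b : ℝ, 0 < ω₂ → 0 < a → 0 ≤ b → ∀ f : ℝ → ℝ,
      Function.Periodic f (2 * π) → Measurable f → Function.Odd f → cellNormSq f < ∞ →
        boltzmannForm ω₂ a b f = 0 →
          ∃ ψ : ℝ → ℝ, ContDiff ℝ 3 ψ ∧ Function.Periodic ψ (2 * π) ∧ Function.Odd ψ ∧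
            IsCollisionalInvariant ω₂ ψ ∧
              f =ᵐ[MeasureTheory.volume.restrict (Set.Ioc (-π) π)] ψ := by
  sorry

/-- **S3 — ODD ESSENTIAL GAP (the analytic estimate; uses `0 < a`).** For `ω₂ > 0`, `a > 0`,
`b ≥ 0` there is `v₀ > 0` such that every sequence `f_n` of odd `2π`-periodic measurable functions
with `‖f_n‖²_{L²(cell)} = 1` that is WEAKLY NULL on the cell (`∫_{cell} φ f_n → 0` for every
`φ ∈ L²(cell)`) has `liminf q(f_n) ≥ v₀`: the bottom of the odd essential spectrum of the form is
positive. Strictly weaker than the crux (which bounds `q ≥ g` on ALL odd unit vectors), and exactly its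
"at infinity" half.
Why plausibly true: (i) Lukkarinen's comparison [Luk16 §3.4]: truncate the kernel, `w_ε ≤ w`, to the
complement of `ε`-tubes around the singular loci of the `(k₁,k₃)`-chart (diagonal, the two
branch-crossing = equal-group-velocity curves `S` where `|∂₂Ω|⁻¹ ≍ 1/dist`, and the fold curves of the
coordinate changes `k₃ ↦ h, k₄` where Jacobians are `≍ 1/√dist`; complete list in cdisprove ANALYSIS.md
§3, `{∂₂Ω = 0} ∩ M_np = diag ∪ S` only — triage r1-2 check_fold), so `q ≥ q_ε`; expand the square:
`q_ε(f) = Σ_i ⟨f, ν_i f⟩ - (cross terms)`, where `ν₁(k₁) = ∫dk₃ Σ w_ε ≥ v₀ > 0` for EVERY `k₁` iff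
`a > 0` (on the fibre `k₁ = 0` the vertex is `Φ = a`; cdisprove numerics "V₁ min > 0 iff a > 0") and
the cross terms are integral operators with bounded (after excision) kernels, hence Hilbert–Schmidt,
hence compact: along a weakly-null unit sequence they tend to `0` and `liminf q(f_n) ≥ v₀`.
(ii) Independently, log-coercivity `q(f) + C‖f‖² ≥ c Σ log(2+|n|)|f̂(n)|²` (card
log-coercive-compact-resolvent, `c ≍ a²`; every concentrating/oscillating family tested grows:
Disproof §3(B), kit j005098/j005103) would give `liminf = +∞`. Why it might fail: an excised tube
swallowing a whole fibre `{k₁ = c}` (a degeneration curve with a vertical segment — numerically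
excluded, cdisprove j005122 class of checks), or a weakly-null odd family with bounded-below-zero…
i.e. `q(f_n) → 0` — which would refute the CRUX itself (none found: chirps `0.021 → 0.035`, fold
packets `≍ ε^{-1/2}`, Galerkin bottoms plateau `5.5e-3` at `(1,1,0)`). HONOURS `0 < a`
(`crux_false_without_couplings`, near-miss `not_hasOddSectorGap_zero_onsite`: at `a = 0` the
`ε`-bumps at `k = 0` are a weakly-null odd unit sequence with `q → 0`). Size L (the only stub with no
complete paper proof; Lukkarinen's sketch + the excision bookkeeping).
Leans on: `boltzmannForm`, `collisionWeight`, `resonanceJacobian`, `vertex`, `cellPairing`, `cellNormSq`,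
`boltzmannForm_mono_weight` (Negative.OnsiteReduction, pattern for `q ≥ q_ε`), `resonantSet_finite`;
Mathlib compact operators (`IsCompactOperator`; Hilbert–Schmidt via `MeasureTheory.Lp`); tree
`Literature/Analysis/OperatorTheory/CompactPerturbationSpectrum.lean` (`spectrum_add_compact_dichotomy`,
Weyl-type stability under compact perturbation, if the operator route is taken — the sequence form
above needs only "compact ⇒ `⟨f_n, K f_n⟩ → 0` along weakly-null `f_n`").
[Lukkarinen2016 §3.4 (arXiv:1509.06036 p.25); AokiLukkarinenSpohn2006 (4.11)] -/
theorem stub_oddEssentialGap :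
    ∀ ω₂ a b : ℝ, 0 < ω₂ → 0 < a → 0 ≤ b → ∃ v₀ : ℝ, 0 < v₀ ∧
      ∀ f : ℕ → ℝ → ℝ, (∀ n, Function.Periodic (f n) (2 * π)) → (∀ n, Measurable (f n)) →
        (∀ n, Function.Odd (f n)) → (∀ n, cellNormSq (f n) = 1) →
          (∀ φ : ℝ → ℝ, Measurable φ → cellNormSq φ < ∞ →
              Filter.Tendsto (fun n => cellPairing φ (f n)) Filter.atTop (nhds 0)) →
            ENNReal.ofReal v₀ ≤ Filter.liminf (fun n => boltzmannForm ω₂ a b (f n)) Filter.atTop := by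
  sorry

/-- **S4 — GAP FROM THE ESSENTIAL GAP AND A TRIVIAL ODD KERNEL (the variational closing).** For
`ω₂ > 0` and any vertex: IF the odd essential gap of S3 holds at `(ω₂,a,b)` and every odd
`2π`-periodic measurable `L²` null vector of `q_{ω₂,a,b}` has norm `0`, THEN `HasOddSectorGap ω₂ a b`.
Why true: if no `g > 0` works, pick odd admissible `f_n` with `q(f_n) < ‖f_n‖²/(n+1)` (so
`0 < ‖f_n‖² < ∞`, `q(f_n) < ∞`), normalise (`boltzmannForm_const_mul`, `cellNormSq_const_mul`) to
`‖f_n‖² = 1`, `q(f_n) → 0`; the unit ball of `L²(cell)` is weakly sequentially compact: `f_n ⇀ g`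
along a subsequence. If `g = 0` the subsequence is weakly null and S3's hypothesis gives
`liminf q ≥ v₀ > 0`, contradiction. If `g ≠ 0`, take the odd part of the periodic extension of a
representative (the `f_n` are odd, so it still represents `g`): an odd periodic measurable function
with `0 < ‖g‖² < ∞` and — by WEAK LOWER SEMICONTINUITY of `q` on `L²(cell)` — `q(g) ≤ liminf q(f_n) = 0`,
contradicting the kernel hypothesis. Weak lsc = convexity of `q` (pointwise convexity of the square,
`w ≥ 0`) + strong lsc (Fatou along an a.e.-convergent subsequence; the brackets converge a.e. on the
resonant surface because the pull-backs `(k₁,k₃) ↦ h(k₁,k₃)`, `↦ k₁ + h - k₃` send null sets to null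
sets: `∂₃h ≠ 0` off two curves per row, `∂₃h - 1 ≠ 0` everywhere — Disproof §3(C)) + Mazur. This is the
card's point (b)(iii): the closing uses lsc of the FULL form, never the null space of a truncated one.
Why it might fail: only through the lsc step (a pull-back charging a null set — excluded as above).
Size M–L (Banach–Alaoglu/Mazur for `MeasureTheory.Lp ℝ 2`, transfer between `ℝ → ℝ` with `cellNormSq`
and `Lp`, the Fatou argument). Leans on: `HasOddSectorGap`, `boltzmannForm_const_mul`,
`cellNormSq_const_mul`, `IsCollisionalInvariant.oddPart`-style parity bookkeeping, `resonantSet_finite`;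
TREE functional analysis (proved): `Literature.Analysis.FunctionSpaces.exists_strictMono_tendsto_inner_of_norm_le`
(weak sequential compactness of bounded sequences in a separable Hilbert space, Brezis Thm 3.18 —
apply in `MeasureTheory.Lp ℝ 2 (volume.restrict (Ioc (-π) π))`) and
`Literature.Analysis.FluidPDE.mem_of_tendsto_inner_of_convex_isClosed` (Hilbert-space Mazur: weak
sequential limits stay in closed convex sets — apply to the sublevel sets `{q ≤ c}`, convex and
strongly closed by Fatou, to get weak lsc); Mathlib `MeasureTheory.L2.innerProductSpace`,
`MeasureTheory.lintegral_liminf_le` (Fatou), `tendstoInMeasure_of_tendsto_Lp`,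
`TendstoInMeasure.exists_seq_tendsto_ae`.
[folklore: direct method / Weyl criterion; Brezis2011 Thm 3.7, 3.18; LukkarinenSpohn2008 Prop 2.4 (parity)] -/
theorem stub_gapOfEssentialGap :
    ∀ ω₂ a b : ℝ, 0 < ω₂ →
      (∃ v₀ : ℝ, 0 < v₀ ∧
        ∀ f : ℕ → ℝ → ℝ, (∀ n, Function.Periodic (f n) (2 * π)) → (∀ n, Measurable (f n)) →
          (∀ n, Function.Odd (f n)) → (∀ n, cellNormSq (f n) = 1) →
            (∀ φ : ℝ → ℝ, Measurable φ → cellNormSq φ < ∞ →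
                Filter.Tendsto (fun n => cellPairing φ (f n)) Filter.atTop (nhds 0)) →
              ENNReal.ofReal v₀ ≤
                Filter.liminf (fun n => boltzmannForm ω₂ a b (f n)) Filter.atTop) →
      (∀ f : ℝ → ℝ, Function.Periodic f (2 * π) → Measurable f → Function.Odd f →
          cellNormSq f < ∞ → boltzmannForm ω₂ a b f = 0 → cellNormSq f = 0) →
        HasOddSectorGap ω₂ a b := by
  sorry

/-! ## 2. The composition (kernel-checked; no `sorry` of its own)

`FGRGap_of : stub_foldJetRigidity → stub_nullVectorRegularity → stub_oddEssentialGap →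
stub_gapOfEssentialGap → FGRGap`, assembled from the registered stubs directly. -/

/-- S1 + parity: an odd `C³` periodic collisional invariant vanishes identically
(`c + dω` odd with `ω` even forces `c + dω ≡ 0`). This is the only instance of S1 the crux consumes. -/
theorem noOddSmoothInvariant {ω₂ : ℝ} (hω : 0 < ω₂) {ψ : ℝ → ℝ} (hC : ContDiff ℝ 3 ψ)
    (hper : Function.Periodic ψ (2 * π)) (hodd : Function.Odd ψ)
    (hinv : IsCollisionalInvariant ω₂ ψ) : ∀ k : ℝ, ψ k = 0 := by
  obtain ⟨c, d, hcd⟩ := stub_foldJetRigidity ω₂ hω ψ hC hper hinv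
  intro k
  have h1 := hcd k
  have h2 := hcd (-k)
  rw [dispersion_neg] at h2
  have h3 : ψ (-k) = -ψ k := hodd k
  linarith

/-- RESHAPE OPTION (documented as an `example`, not used by `FGRGap_of`): the odd instance of S1
also follows from an odd-`C¹` classification in the exact hypothesis shape of gen-1's evidence theorem
`eq_zero_of_odd_isCollisionalInvariant` (NoOddC1Invariant.lean, 2026-08-15T22:49Z: `HasDerivAt`
everywhere, continuous derivative, odd, `2π`-periodic, invariant ⇒ `ψ = 0`). A lead who lands that
file may replace `stub_foldJetRigidity` by this hypothesis' statement; `C³` feeds it as shown. -/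
example
    (h : ∀ ω₂ : ℝ, 0 < ω₂ → ∀ ψ ψ' : ℝ → ℝ, (∀ k, HasDerivAt ψ (ψ' k) k) → Continuous ψ' →
      Function.Odd ψ → Function.Periodic ψ (2 * π) → IsCollisionalInvariant ω₂ ψ → ψ = 0)
    {ω₂ : ℝ} (hω : 0 < ω₂) {ψ : ℝ → ℝ} (hC : ContDiff ℝ 3 ψ)
    (hper : Function.Periodic ψ (2 * π)) (hodd : Function.Odd ψ)
    (hinv : IsCollisionalInvariant ω₂ ψ) : ∀ k : ℝ, ψ k = 0 := by
  have h1 : (1 : WithTop ℕ∞) ≤ 3 := by norm_num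
  have h0 : (3 : WithTop ℕ∞) ≠ 0 := by norm_num
  have hd : Differentiable ℝ ψ := hC.differentiable h0
  have hψ : ψ = 0 :=
    h ω₂ hω ψ (deriv ψ) (fun k => (hd k).hasDerivAt) (hC.continuous_deriv h1) hodd hper hinv
  intro k
  simp [hψ]

/-- S2 + `noOddSmoothInvariant`: the form has no odd `L²` null vector of positive norm
(`0 < a`, `0 ≤ b`) — the kernel hypothesis of S4. -/
theorem noOddNullVector {ω₂ a b : ℝ} (hω : 0 < ω₂) (ha : 0 < a) (hb : 0 ≤ b) :
    ∀ f : ℝ → ℝ, Function.Periodic f (2 * π) → Measurable f → Function.Odd f →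
      cellNormSq f < ∞ → boltzmannForm ω₂ a b f = 0 → cellNormSq f = 0 := by
  intro f hper hmeas hodd hfin hq
  obtain ⟨ψ, hC, hψper, hψodd, hinv, hae⟩ :=
    stub_nullVectorRegularity ω₂ a b hω ha hb f hper hmeas hodd hfin hq
  have hψ0 : ∀ k : ℝ, ψ k = 0 := noOddSmoothInvariant hω hC hψper hψodd hinv
  have hf0 : (fun k => ENNReal.ofReal (f k ^ 2)) =ᵐ[volume.restrict (Set.Ioc (-π) π)]
      fun _ => (0 : ℝ≥0∞) :=
    hae.mono fun k hk => by
      show ENNReal.ofReal (f k ^ 2) = 0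
      rw [hk, hψ0 k]
      simp
  unfold cellNormSq
  calc ∫⁻ k in Set.Ioc (-π) π, ENNReal.ofReal (f k ^ 2)
      = ∫⁻ _ in Set.Ioc (-π) π, (0 : ℝ≥0∞) := lintegral_congr_ae hf0
    _ = 0 := lintegral_zero

/-- S4 fed with S3 and `noOddNullVector`: the odd-sector gap for `ω₂ > 0`, `a > 0` and every `b ≥ 0`
(so the line also gives ALS's on-site model `b = 0`, which the crux needs by `onsite_of_crux`). -/
theorem hasOddSectorGap_of_stubs (ω₂ a b : ℝ) (hω : 0 < ω₂) (ha : 0 < a) (hb : 0 ≤ b) :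
    HasOddSectorGap ω₂ a b :=
  stub_gapOfEssentialGap ω₂ a b hω (stub_oddEssentialGap ω₂ a b hω ha hb) (noOddNullVector hω ha hb)

/-- **The line concludes the crux BY NAME** (modulo the four registered stubs). -/
theorem FGRGap_of : Summit.AtomisticToContinuum.FouriersLaw.Theses.EmbeddedDrudeMourre.FGRGap :=
  fgrGap_iff.mpr fun ω₂ a b hω ha hb => hasOddSectorGap_of_stubs ω₂ a b hω ha hb.le

/-! ## 3. Checks against the landed Negative lemmas (imported) -/

/-- Consistency with `Negative.OnsiteReduction.onsite_of_crux` (the `b = 0` gap is NECESSARY for the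
crux): the stubs deliver it directly, with the same constant-free statement. -/
example {ω₂ : ℝ} (hω : 0 < ω₂) : HasOddSectorGap ω₂ 1 0 :=
  hasOddSectorGap_of_stubs ω₂ 1 0 hω one_pos le_rfl

example : Summit.AtomisticToContinuum.FouriersLaw.Theses.EmbeddedDrudeMourre.FGRGap →
    ∀ ω₂ : ℝ, 0 < ω₂ → HasOddSectorGap ω₂ 1 0 :=
  fun h _ hω => Negative.OnsiteReduction.onsite_of_crux h hω

/-- The kernel hypothesis of S4 is load-bearing and is where the couplings enter S1–S2's side: for
the harmonic vertex `a = b = 0` it is FALSE (`sin` is an odd null vector of positive norm —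
`Negative.LoadBearing.boltzmannForm_zero_zero`, `cellNormSq_sin_pos`), matching
`crux_false_without_couplings`. -/
example (ω₂ : ℝ) :
    ¬ ∀ f : ℝ → ℝ, Function.Periodic f (2 * π) → Measurable f → Function.Odd f →
        cellNormSq f < ∞ → boltzmannForm ω₂ 0 0 f = 0 → cellNormSq f = 0 := fun h =>
  Negative.LoadBearing.cellNormSq_sin_pos.ne'
    (h Real.sin Real.sin_periodic Real.measurable_sin (fun k => Real.sin_neg k)
      Negative.LoadBearing.cellNormSq_sin_lt_top (Negative.LoadBearing.boltzmannForm_zero_zero ω₂ Real.sin))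

/-- `0 < a` cannot be dropped from S3/`hasOddSectorGap_of_stubs` (both couplings dropped is refuted
outright; `a = 0 < b` is the disprover's sorried near-miss, honoured by S3's hypothesis). -/
example : ¬ ∀ ω₂ a b : ℝ, 0 < ω₂ → HasOddSectorGap ω₂ a b :=
  Negative.LoadBearing.crux_false_without_couplings

end Summit.AtomisticToContinuum.FouriersLaw.Cruxes.FGRGap.FoldJetRigidity

end
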